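import Mathlib
import HarnessLib
import Summits.HubbardSuperconductivity.HubbardSuperconductivity.Theorems.KLProgrammeKLRegimeVolumeLimitTwoTimeSplitPairCast
import Summits.HubbardSuperconductivity.HubbardSuperconductivity.Theorems.KLProgrammeKLRegimeVolumeLimitTwoPointTimeMatch
import Literature.MathematicalPhysics.QuantumLattice.ShiftedHubbardTwoTimeDeterminant

/-!
# Child `KLRegimeVolumeLimitV14` (stmt-HubbardSuperconductivity-19921), `stub_vl_bound` via (H1): **C2 IS A THEOREM** — the free trace of the
# two-time split-pair word equals `Z₀ · (−det Ẽ)` (seat hubbard-kl-k3c5-p2, g4; technique «analytic-continuation-free assembly via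
# FinalTwoLegVolLimit»)

The one pointwise hypothesis `hC2` of k3c4-p2's `hasSum_twoPointLimitDet_series_time_of_C2` / `tendsto_twoPoint_hamiltonian_of_C2`
(p492690) is discharged here by a DETERMINANT CHAIN through pieces that are all in the tree:

1. `gibbsState_apply` + k3c5-p1's two-time shifted Wick theorem `gibbsState_dGamma_twoTime_shiftedHubbardWord_eq_neg_det` (p490677,
   `ν ≡ ½`): `Tr(e^{−βdΓh}·word) = Z₀ · (−det(Msplit − D))`, `Msplit` = `splitPairMatrix β h (2k) (2k+2j)` of the block letter data;
2. `twoTimeHamMatrix_append_eq_splitPairMatrix` (`…TwoTimeSplitPairCast`): `Msplit` IS k3c5-p1's `twoTimeHamMatrix β μ (2k)` of the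
   APPEND-form pair data (sites `x_{a(m)}`, spins `m % 2`, Grassmann times `t = β(1−u) ⧺ (s − βu′)`);
3. k3c5-p1's determinant identity `twoTime_det_vertexLimit_eq_neg_det` (p492846) on that ordered configuration:
   `det(twoTimeHamMatrix − diag(0,½,…,½)) = −det twoTimeLimitMatrix` — its six ordering hypotheses are checked blockwise from
   `StrictMono u, u′` and the `Ioo` ranges;
4. the `Fin`-cast `2k+2j = (k+j)·2` (`det_twoTimeLimitMatrix_comp_cast`) and the pair-data access identities;
5. k3c5-p1's `twoPointLimitMatrix_time_eq_twoTimeLimitMatrix` (p493232): `twoTimeLimitMatrix` of the pair data IS the (H1) matrix;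
6. k3c4-p2's pointwise match `twoPointTimeDet_eq_neg_det_beforeRule` (p489878): the (H1) determinant is `−det Ẽ`.

Main results: **`det_splitPairMatrix_sub_diagonal_eq_det_beforeRule`** (`det(Msplit − D) = det Ẽ`) and
**`gibbsTrace_twoTimeWord_eq_partitionFn_mul_neg_det_beforeRule`** = the `hC2` clause VERBATIM for all spins `σ, σ′` (for `L ≥ 3`,
`0 < s < β`).  Everything is proved; no definition.
-/

noncomputable section

namespace Summit.HubbardSuperconductivity.HubbardSuperconductivity.Theorems.TwoPointAssembly

set_option linter.dupNamespace false -- summit = problem name (single-conjunct summit), D-0017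

open Finset NormedSpace Matrix Literature.MathematicalPhysics.QuantumLattice Literature.Probability.LatticeModels
open Summit.HubbardSuperconductivity.HubbardSuperconductivity.Theorems.MatsubaraAllU
open scoped ComplexOrder

variable {L : ℕ} [NeZero L]

section DetChain

/-- **`det(Msplit − D) = det Ẽ`** on a generic two-block time configuration (`L ≥ 3`, `0 < s < β`, `u` strictly increasing in
`(0,(β−s)/β)`, `u′` strictly increasing in `(0,s/β)`, any vertex sites `f ⧺ f′`): the determinant chain of the module docstring. -/
theorem det_splitPairMatrix_sub_diagonal_eq_det_beforeRule (hL : 3 ≤ L) {β : ℝ} (hβ : 0 < β) (μ : ℝ) (σ σ' : Fin 2)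
    (xe ye : TorusSite 2 L) {s : ℝ} (hs0 : 0 < s) (hsβ : s < β) {k j : ℕ} (f : Fin k → FermionTorus 2 L) (f' : Fin j → FermionTorus 2 L)
    {u : Fin k → ℝ} {u' : Fin j → ℝ} (hu : StrictMono u) (hu' : StrictMono u')
    (huI : ∀ i, u i ∈ Set.Ioo (0 : ℝ) ((β - s) / β)) (hu'I : ∀ l, u' l ∈ Set.Ioo (0 : ℝ) (s / β)) :
    (splitPairMatrix β (hubbardOneBody (fermionTorusGraph 2 L) 1 μ) (k * 2) (k * 2 + j * 2) (Nat.le_add_right (k * 2) (j * 2))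
        (Fin.append (m := k * 2) (n := j * 2 + 1)
          (fun m : Fin (k * 2) => creVec (hubbardOneBody (fermionTorusGraph 2 L) 1 μ) ((((u (finProdFinEquiv.symm m).1 : ℝ) : ℂ)) * -(β : ℂ))
            (orb (f (finProdFinEquiv.symm m).1) (finProdFinEquiv.symm m).2))
          (Fin.cons (creVec (hubbardOneBody (fermionTorusGraph 2 L) 1 μ) ((((β - s) / β : ℝ) : ℂ) * -(β : ℂ)) (orb (FermionTorus.ofTorusSite xe) σ))
            (fun m : Fin (j * 2) => creVec (hubbardOneBody (fermionTorusGraph 2 L) 1 μ) (((((β - s) / β + u' (finProdFinEquiv.symm m).1 : ℝ) : ℂ)) * -(β : ℂ))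
              (orb (f' (finProdFinEquiv.symm m).1) (finProdFinEquiv.symm m).2)) :
            Fin (j * 2 + 1) → Orb (FermionTorus 2 L) → ℂ) : Fin (k * 2 + j * 2 + 1) → Orb (FermionTorus 2 L) → ℂ)
        (Fin.cons (annVec (hubbardOneBody (fermionTorusGraph 2 L) 1 μ) 0 (orb (FermionTorus.ofTorusSite ye) σ'))
          (Fin.append
            (fun m : Fin (k * 2) => annVec (hubbardOneBody (fermionTorusGraph 2 L) 1 μ) ((((u (finProdFinEquiv.symm m).1 : ℝ) : ℂ)) * -(β : ℂ))
              (orb (f (finProdFinEquiv.symm m).1) (finProdFinEquiv.symm m).2))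
            (fun m : Fin (j * 2) => annVec (hubbardOneBody (fermionTorusGraph 2 L) 1 μ) (((((β - s) / β + u' (finProdFinEquiv.symm m).1 : ℝ) : ℂ)) * -(β : ℂ))
              (orb (f' (finProdFinEquiv.symm m).1) (finProdFinEquiv.symm m).2))) :
          Fin (k * 2 + j * 2 + 1) → Orb (FermionTorus 2 L) → ℂ) -
      Matrix.diagonal (Fin.cons 0 (Fin.append (fun _ : Fin (k * 2) => ((1 / 2 : ℝ) : ℂ)) (fun _ : Fin (j * 2) => ((1 / 2 : ℝ) : ℂ))) :
          Fin (k * 2 + j * 2 + 1) → ℂ)).det =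
      (Matrix.of (Fin.cases
          (Fin.cases
            (-(exp (-((0 : ℂ) • hubbardOneBody (fermionTorusGraph 2 L) 1 μ)) *
                (1 + exp (-((β : ℂ) • hubbardOneBody (fermionTorusGraph 2 L) 1 μ)))⁻¹ *
                exp (((((β - s) / β : ℝ) : ℂ) * -(β : ℂ)) • hubbardOneBody (fermionTorusGraph 2 L) 1 μ))
              (orb (FermionTorus.ofTorusSite ye) σ') (orb (FermionTorus.ofTorusSite xe) σ))
            (fun m' : Fin ((k + j) * 2) =>
              if k ≤ ((finProdFinEquiv.symm m' : Fin (k + j) × Fin 2).1 : ℕ) then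
                (exp (-((((Fin.append u (fun l => (β - s) / β + u' l) (finProdFinEquiv.symm m' : Fin (k + j) × Fin 2).1 : ℝ) : ℂ) *
                      -(β : ℂ)) • hubbardOneBody (fermionTorusGraph 2 L) 1 μ)) *
                    (1 + exp ((β : ℂ) • hubbardOneBody (fermionTorusGraph 2 L) 1 μ))⁻¹ *
                    exp (((((β - s) / β : ℝ) : ℂ) * -(β : ℂ)) • hubbardOneBody (fermionTorusGraph 2 L) 1 μ))
                  (orb (FermionTorus.ofTorusSite (FermionTorus.toTorusSite (Fin.append f f' (finProdFinEquiv.symm m' : Fin (k + j) × Fin 2).1)))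
                    (finProdFinEquiv.symm m' : Fin (k + j) × Fin 2).2) (orb (FermionTorus.ofTorusSite xe) σ)
              else
                -(exp (-((((Fin.append u (fun l => (β - s) / β + u' l) (finProdFinEquiv.symm m' : Fin (k + j) × Fin 2).1 : ℝ) : ℂ) *
                      -(β : ℂ)) • hubbardOneBody (fermionTorusGraph 2 L) 1 μ)) *
                    (1 + exp (-((β : ℂ) • hubbardOneBody (fermionTorusGraph 2 L) 1 μ)))⁻¹ *
                    exp (((((β - s) / β : ℝ) : ℂ) * -(β : ℂ)) • hubbardOneBody (fermionTorusGraph 2 L) 1 μ))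
                  (orb (FermionTorus.ofTorusSite (FermionTorus.toTorusSite (Fin.append f f' (finProdFinEquiv.symm m' : Fin (k + j) × Fin 2).1)))
                    (finProdFinEquiv.symm m' : Fin (k + j) × Fin 2).2) (orb (FermionTorus.ofTorusSite xe) σ)))
          (fun m : Fin ((k + j) * 2) => Fin.cases
            (-(exp (-((0 : ℂ) • hubbardOneBody (fermionTorusGraph 2 L) 1 μ)) *
                (1 + exp (-((β : ℂ) • hubbardOneBody (fermionTorusGraph 2 L) 1 μ)))⁻¹ *
                exp ((((Fin.append u (fun l => (β - s) / β + u' l) (finProdFinEquiv.symm m : Fin (k + j) × Fin 2).1 : ℝ) : ℂ) *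
                  -(β : ℂ)) • hubbardOneBody (fermionTorusGraph 2 L) 1 μ))
              (orb (FermionTorus.ofTorusSite ye) σ')
              (orb (FermionTorus.ofTorusSite (FermionTorus.toTorusSite (Fin.append f f' (finProdFinEquiv.symm m : Fin (k + j) × Fin 2).1)))
                (finProdFinEquiv.symm m : Fin (k + j) × Fin 2).2))
            (fun m' : Fin ((k + j) * 2) =>
              twoPointWordMatrix L β μ σ σ' xe ye (fun a => FermionTorus.toTorusSite (Fin.append f f' a)) (Fin.append u (fun l => (β - s) / β + u' l)) m.succ m'.succ)) :
          Fin ((k + j) * 2 + 1) → Fin ((k + j) * 2 + 1) → ℂ)).det := by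
  have hβ0 : β ≠ 0 := hβ.ne'
  have hcast : k * 2 + j * 2 = (k + j) * 2 := by ring
  -- facts on the two blocks of Grassmann times
  have hβa : β * ((β - s) / β) = β - s := by field_simp
  have hblk2 : ∀ l, β * (1 - ((β - s) / β + u' l)) = s - β * u' l := fun l => by
    rw [mul_sub, mul_add, hβa]; ring
  have hL1 : ∀ i, s < β * (1 - u i) := fun i => by
    have h1 := (lt_div_iff₀ hβ).1 (huI i).2
    rw [mul_sub, mul_one]
    linarith [mul_comm (u i) β]
  have hR1 : ∀ l, β * (1 - ((β - s) / β + u' l)) < s := fun l => by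
    rw [hblk2]
    linarith [mul_pos hβ (hu'I l).1]
  have hR0 : ∀ l, 0 < β * (1 - ((β - s) / β + u' l)) := fun l => by
    rw [hblk2]
    have h1 := (lt_div_iff₀ hβ).1 (hu'I l).2
    linarith [mul_comm (u' l) β]
  -- (1)+(2): `Msplit = twoTimeHamMatrix`, and the diagonal
  rw [← twoTimeHamMatrix_append_eq_splitPairMatrix hβ0 μ σ σ' xe ye s f f' u u']
  have hD : (Fin.cons 0 (Fin.append (fun _ : Fin (k * 2) => ((1 / 2 : ℝ) : ℂ)) (fun _ : Fin (j * 2) => ((1 / 2 : ℝ) : ℂ))) :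
          Fin (k * 2 + j * 2 + 1) → ℂ) =
      (Fin.cons (0 : ℂ) (fun _ : Fin (k * 2 + j * 2) => (1 / 2 : ℂ)) : Fin (k * 2 + j * 2 + 1) → ℂ) := by
    congr 1
    funext m
    induction m using Fin.addCases with
    | left a => simp only [Fin.append_left]; push_cast; ring
    | right b => simp only [Fin.append_right]; push_cast; ring
  rw [hD]
  -- (3): k3c5-p1's determinant identity on the ordered configuration
  have h46 := twoTime_det_vertexLimit_eq_neg_det hL β μ (hK := Nat.le_add_right (k * 2) (j * 2))
    (y := (Fin.append (fun m : Fin (k * 2) => FermionTorus.toTorusSite (f (finProdFinEquiv.symm m).1))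
          (fun m : Fin (j * 2) => FermionTorus.toTorusSite (f' (finProdFinEquiv.symm m).1)) : Fin (k * 2 + j * 2) → TorusSite 2 L))
    (ς := (Fin.append (fun m : Fin (k * 2) => (finProdFinEquiv.symm m).2) (fun m : Fin (j * 2) => (finProdFinEquiv.symm m).2) :
          Fin (k * 2 + j * 2) → Fin 2))
    (t := (Fin.append (fun m : Fin (k * 2) => β * (1 - u (finProdFinEquiv.symm m).1))
          (fun m : Fin (j * 2) => β * (1 - ((β - s) / β + u' (finProdFinEquiv.symm m).1))) : Fin (k * 2 + j * 2) → ℝ))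
    (xe := xe) (ye := ye) (σ := σ) (σ' := σ') hs0 ?ht0 ?hts ?hKt ?hmono ?hsep
  case ht0 =>
    intro m
    induction m using Fin.addCases with
    | left a => simp only [Fin.append_left]; linarith [hL1 (finProdFinEquiv.symm a).1]
    | right b => simp only [Fin.append_right]; exact hR0 _
  case hts =>
    intro m
    induction m using Fin.addCases with
    | left a => simp only [Fin.append_left]; exact (hL1 _).ne'
    | right b => simp only [Fin.append_right]; exact (hR1 _).ne
  case hKt =>
    intro m
    induction m using Fin.addCases with
    | left a =>
      simp only [Fin.append_left, Fin.val_castAdd]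
      exact iff_of_false (not_le.2 a.isLt) (not_lt.2 (hL1 _).le)
    | right b =>
      simp only [Fin.append_right, Fin.val_natAdd]
      exact iff_of_true (Nat.le_add_right _ _) (hR1 _)
  case hmono =>
    intro m m' hmm'
    have hv : (m : ℕ) < (m' : ℕ) := Fin.lt_def.1 hmm'
    induction m using Fin.addCases with
    | left a =>
      induction m' using Fin.addCases with
      | left a' =>
        simp only [Fin.append_left]
        simp only [Fin.val_castAdd] at hv
        have hle : (finProdFinEquiv.symm a : Fin k × Fin 2).1 ≤ (finProdFinEquiv.symm a' : Fin k × Fin 2).1 := by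
          simp only [finProdFinEquiv_symm_apply]
          exact Fin.le_def.2 (by simp only [Fin.coe_divNat]; exact Nat.div_le_div_right hv.le)
        have hule := hu.monotone hle
        exact mul_le_mul_of_nonneg_left (by linarith) hβ.le
      | right b' =>
        simp only [Fin.append_left, Fin.append_right]
        exact ((hR1 _).trans (hL1 _)).le
    | right b =>
      induction m' using Fin.addCases with
      | left a' =>
        exfalso
        simp only [Fin.val_natAdd, Fin.val_castAdd] at hv
        have := a'.isLt
        omega
      | right b' =>
        simp only [Fin.append_right]
        simp only [Fin.val_natAdd] at hv
        have hle : (finProdFinEquiv.symm b : Fin j × Fin 2).1 ≤ (finProdFinEquiv.symm b' : Fin j × Fin 2).1 := by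
          simp only [finProdFinEquiv_symm_apply]
          exact Fin.le_def.2 (by simp only [Fin.coe_divNat]; exact Nat.div_le_div_right (by omega))
        have hule := hu'.monotone hle
        rw [hblk2, hblk2]
        nlinarith [hβ]
  case hsep =>
    intro m m' hne heq
    induction m using Fin.addCases with
    | left a =>
      induction m' using Fin.addCases with
      | left a' =>
        simp only [Fin.append_left] at heq ⊢
        have h1 : u (finProdFinEquiv.symm a : Fin k × Fin 2).1 = u (finProdFinEquiv.symm a' : Fin k × Fin 2).1 := by
          have := mul_left_cancel₀ hβ0 heq
          linarith
        have h2 := hu.injective h1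
        intro h3
        exact hne (by rw [finProdFinEquiv.symm.injective (Prod.ext h2 h3)])
      | right b' =>
        simp only [Fin.append_left, Fin.append_right] at heq
        exact absurd heq (ne_of_gt ((hR1 _).trans (hL1 _)))
    | right b =>
      induction m' using Fin.addCases with
      | left a' =>
        simp only [Fin.append_left, Fin.append_right] at heq
        exact absurd heq (ne_of_lt ((hR1 _).trans (hL1 _)))
      | right b' =>
        simp only [Fin.append_right] at heq ⊢
        have h1 : u' (finProdFinEquiv.symm b : Fin j × Fin 2).1 = u' (finProdFinEquiv.symm b' : Fin j × Fin 2).1 := by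
          rw [hblk2, hblk2] at heq
          have : β * u' (finProdFinEquiv.symm b : Fin j × Fin 2).1 = β * u' (finProdFinEquiv.symm b' : Fin j × Fin 2).1 := by
            linarith
          exact mul_left_cancel₀ hβ0 this
        have h2 := hu'.injective h1
        intro h3
        exact hne (by rw [finProdFinEquiv.symm.injective (Prod.ext h2 h3)])
  have h46' := congrArg Neg.neg h46
  rw [neg_neg] at h46'
  rw [← h46']
  -- (4): the cast `2k+2j = (k+j)·2`
  rw [twoTime_pairSite_append_eq_cast hcast f f', twoTime_pairSpin_append_eq_cast hcast,
    twoTime_pairTime_append_eq_cast hcast β s u u',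
    det_twoTimeLimitMatrix_comp_cast β μ hcast
      (fun m' : Fin ((k + j) * 2) => FermionTorus.toTorusSite (Fin.append f f' (finProdFinEquiv.symm m' : Fin (k + j) × Fin 2).1))
      (fun m' : Fin ((k + j) * 2) => (finProdFinEquiv.symm m' : Fin (k + j) × Fin 2).2)
      (fun m' : Fin ((k + j) * 2) => β * (1 - Fin.append u (fun l => (β - s) / β + u' l) (finProdFinEquiv.symm m' : Fin (k + j) × Fin 2).1)) xe ye σ σ' s]
  -- (5): the (H1) matrix; (6): k3c4-p2's pointwise match
  rw [← twoPointLimitMatrix_time_eq_twoTimeLimitMatrix β μ σ σ' xe ye (fun a => FermionTorus.toTorusSite (Fin.append f f' a))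
    (fun a : Fin (k + j) => β * (1 - Fin.append u (fun l => (β - s) / β + u' l) a)) s,
    twoPointTimeDet_eq_neg_det_beforeRule hL hβ μ σ σ' xe ye hs0 hsβ (fun a => FermionTorus.toTorusSite (Fin.append f f' a))
      hu hu' huI hu'I, neg_neg]

/-- **C2 (k3c5-p1) IS A THEOREM — the `hC2` clause of `tendsto_twoPoint_hamiltonian_of_C2` (p492690) verbatim, all spins.**
For `L ≥ 3`, `0 < s < β`: on every generic two-block time configuration and all vertex sites, the free (`dΓ h`) trace of the two-time
split-pair word `c_{ȳₑσ′}·∏Ṽ(−βu_i)·c†_{x̄ₑσ}(−β(β−s)/β)·∏Ṽ(−β((β−s)/β+u′_l))` equals `Z₀ · (−det Ẽ)`. -/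
theorem gibbsTrace_twoTimeWord_eq_partitionFn_mul_neg_det_beforeRule (hL : 3 ≤ L) {β : ℝ} (hβ : 0 < β) (μ : ℝ) (σ σ' : Fin 2)
    (xe ye : TorusSite 2 L) {s : ℝ} (hs0 : 0 < s) (hsβ : s < β) :
    ∀ (k j : ℕ) (u : Fin k → ℝ) (u' : Fin j → ℝ), StrictMono u → StrictMono u' →
      (∀ i, u i ∈ Set.Ioo (0 : ℝ) ((β - s) / β)) → (∀ l, u' l ∈ Set.Ioo (0 : ℝ) (s / β)) →
      ∀ (f : Fin k → FermionTorus 2 L) (f' : Fin j → FermionTorus 2 L),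
        (Matrix.gibbsWeight β (dGamma (hubbardOneBody (fermionTorusGraph 2 L) 1 μ)) * (annihilation (orb (FermionTorus.ofTorusSite ye) σ') *
                ((List.ofFn fun i : Fin k =>
                    ((exp ((((u i : ℝ) : ℂ) * -(β : ℂ)) • dGamma (hubbardOneBody (fermionTorusGraph 2 L) 1 μ)) * creation (orb (f i) 0) *
                          exp (-((((u i : ℝ) : ℂ) * -(β : ℂ)) • dGamma (hubbardOneBody (fermionTorusGraph 2 L) 1 μ)))) *
                        (exp ((((u i : ℝ) : ℂ) * -(β : ℂ)) • dGamma (hubbardOneBody (fermionTorusGraph 2 L) 1 μ)) * annihilation (orb (f i) 0) *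
                          exp (-((((u i : ℝ) : ℂ) * -(β : ℂ)) • dGamma (hubbardOneBody (fermionTorusGraph 2 L) 1 μ)))) -
                      ((1 / 2 : ℝ) : ℂ) • (1 : Matrix (Finset (Orb (FermionTorus 2 L))) (Finset (Orb (FermionTorus 2 L))) ℂ)) *
                    ((exp ((((u i : ℝ) : ℂ) * -(β : ℂ)) • dGamma (hubbardOneBody (fermionTorusGraph 2 L) 1 μ)) * creation (orb (f i) 1) *
                          exp (-((((u i : ℝ) : ℂ) * -(β : ℂ)) • dGamma (hubbardOneBody (fermionTorusGraph 2 L) 1 μ)))) *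
                        (exp ((((u i : ℝ) : ℂ) * -(β : ℂ)) • dGamma (hubbardOneBody (fermionTorusGraph 2 L) 1 μ)) * annihilation (orb (f i) 1) *
                          exp (-((((u i : ℝ) : ℂ) * -(β : ℂ)) • dGamma (hubbardOneBody (fermionTorusGraph 2 L) 1 μ)))) -
                      ((1 / 2 : ℝ) : ℂ) • (1 : Matrix (Finset (Orb (FermionTorus 2 L))) (Finset (Orb (FermionTorus 2 L))) ℂ))).prod *
                  (exp (((((β - s) / β : ℝ) : ℂ) * -(β : ℂ)) • dGamma (hubbardOneBody (fermionTorusGraph 2 L) 1 μ)) * creation (orb (FermionTorus.ofTorusSite xe) σ) *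
                    exp (-(((((β - s) / β : ℝ) : ℂ) * -(β : ℂ)) • dGamma (hubbardOneBody (fermionTorusGraph 2 L) 1 μ)))) *
                  (List.ofFn fun l : Fin j =>
                    ((exp ((((((β - s) / β + u' l : ℝ) : ℂ)) * -(β : ℂ)) • dGamma (hubbardOneBody (fermionTorusGraph 2 L) 1 μ)) * creation (orb (f' l) 0) *
                          exp (-((((((β - s) / β + u' l : ℝ) : ℂ)) * -(β : ℂ)) • dGamma (hubbardOneBody (fermionTorusGraph 2 L) 1 μ)))) *
                        (exp ((((((β - s) / β + u' l : ℝ) : ℂ)) * -(β : ℂ)) • dGamma (hubbardOneBody (fermionTorusGraph 2 L) 1 μ)) *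
                            annihilation (orb (f' l) 0) *
                          exp (-((((((β - s) / β + u' l : ℝ) : ℂ)) * -(β : ℂ)) • dGamma (hubbardOneBody (fermionTorusGraph 2 L) 1 μ)))) -
                      ((1 / 2 : ℝ) : ℂ) • (1 : Matrix (Finset (Orb (FermionTorus 2 L))) (Finset (Orb (FermionTorus 2 L))) ℂ)) *
                    ((exp ((((((β - s) / β + u' l : ℝ) : ℂ)) * -(β : ℂ)) • dGamma (hubbardOneBody (fermionTorusGraph 2 L) 1 μ)) * creation (orb (f' l) 1) *
                          exp (-((((((β - s) / β + u' l : ℝ) : ℂ)) * -(β : ℂ)) • dGamma (hubbardOneBody (fermionTorusGraph 2 L) 1 μ)))) *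
                        (exp ((((((β - s) / β + u' l : ℝ) : ℂ)) * -(β : ℂ)) • dGamma (hubbardOneBody (fermionTorusGraph 2 L) 1 μ)) *
                            annihilation (orb (f' l) 1) *
                          exp (-((((((β - s) / β + u' l : ℝ) : ℂ)) * -(β : ℂ)) • dGamma (hubbardOneBody (fermionTorusGraph 2 L) 1 μ)))) -
                      ((1 / 2 : ℝ) : ℂ) • (1 : Matrix (Finset (Orb (FermionTorus 2 L))) (Finset (Orb (FermionTorus 2 L))) ℂ))).prod))).trace =
          Matrix.partitionFn β (dGamma (hubbardOneBody (fermionTorusGraph 2 L) 1 μ)) * -(Matrix.of (Fin.cases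
          (Fin.cases
            (-(exp (-((0 : ℂ) • hubbardOneBody (fermionTorusGraph 2 L) 1 μ)) *
                (1 + exp (-((β : ℂ) • hubbardOneBody (fermionTorusGraph 2 L) 1 μ)))⁻¹ *
                exp (((((β - s) / β : ℝ) : ℂ) * -(β : ℂ)) • hubbardOneBody (fermionTorusGraph 2 L) 1 μ))
              (orb (FermionTorus.ofTorusSite ye) σ') (orb (FermionTorus.ofTorusSite xe) σ))
            (fun m' : Fin ((k + j) * 2) =>
              if k ≤ ((finProdFinEquiv.symm m' : Fin (k + j) × Fin 2).1 : ℕ) then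
                (exp (-((((Fin.append u (fun l => (β - s) / β + u' l) (finProdFinEquiv.symm m' : Fin (k + j) × Fin 2).1 : ℝ) : ℂ) *
                      -(β : ℂ)) • hubbardOneBody (fermionTorusGraph 2 L) 1 μ)) *
                    (1 + exp ((β : ℂ) • hubbardOneBody (fermionTorusGraph 2 L) 1 μ))⁻¹ *
                    exp (((((β - s) / β : ℝ) : ℂ) * -(β : ℂ)) • hubbardOneBody (fermionTorusGraph 2 L) 1 μ))
                  (orb (FermionTorus.ofTorusSite (FermionTorus.toTorusSite (Fin.append f f' (finProdFinEquiv.symm m' : Fin (k + j) × Fin 2).1)))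
                    (finProdFinEquiv.symm m' : Fin (k + j) × Fin 2).2) (orb (FermionTorus.ofTorusSite xe) σ)
              else
                -(exp (-((((Fin.append u (fun l => (β - s) / β + u' l) (finProdFinEquiv.symm m' : Fin (k + j) × Fin 2).1 : ℝ) : ℂ) *
                      -(β : ℂ)) • hubbardOneBody (fermionTorusGraph 2 L) 1 μ)) *
                    (1 + exp (-((β : ℂ) • hubbardOneBody (fermionTorusGraph 2 L) 1 μ)))⁻¹ *
                    exp (((((β - s) / β : ℝ) : ℂ) * -(β : ℂ)) • hubbardOneBody (fermionTorusGraph 2 L) 1 μ))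
                  (orb (FermionTorus.ofTorusSite (FermionTorus.toTorusSite (Fin.append f f' (finProdFinEquiv.symm m' : Fin (k + j) × Fin 2).1)))
                    (finProdFinEquiv.symm m' : Fin (k + j) × Fin 2).2) (orb (FermionTorus.ofTorusSite xe) σ)))
          (fun m : Fin ((k + j) * 2) => Fin.cases
            (-(exp (-((0 : ℂ) • hubbardOneBody (fermionTorusGraph 2 L) 1 μ)) *
                (1 + exp (-((β : ℂ) • hubbardOneBody (fermionTorusGraph 2 L) 1 μ)))⁻¹ *
                exp ((((Fin.append u (fun l => (β - s) / β + u' l) (finProdFinEquiv.symm m : Fin (k + j) × Fin 2).1 : ℝ) : ℂ) *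
                  -(β : ℂ)) • hubbardOneBody (fermionTorusGraph 2 L) 1 μ))
              (orb (FermionTorus.ofTorusSite ye) σ')
              (orb (FermionTorus.ofTorusSite (FermionTorus.toTorusSite (Fin.append f f' (finProdFinEquiv.symm m : Fin (k + j) × Fin 2).1)))
                (finProdFinEquiv.symm m : Fin (k + j) × Fin 2).2))
            (fun m' : Fin ((k + j) * 2) =>
              twoPointWordMatrix L β μ σ σ' xe ye (fun a => FermionTorus.toTorusSite (Fin.append f f' a)) (Fin.append u (fun l => (β - s) / β + u' l)) m.succ m'.succ)) :
          Fin ((k + j) * 2 + 1) → Fin ((k + j) * 2 + 1) → ℂ)).det := by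
  intro k j u u' hu hu' huI hu'I f f'
  haveI : Nonempty (Finset (Orb (FermionTorus 2 L))) := ⟨∅⟩
  -- instance alignment: generic-`Λ` theorems carry `LinearOrder.toDecidableEq`, torus statements `instDecidableEqLex`
  have hinst : (LinearOrder.toDecidableEq : DecidableEq (FermionTorus 2 L)) = instDecidableEqLex (Fin 2 → Fin L) :=
    Subsingleton.elim _ _
  have hZ₀ : Matrix.partitionFn β (dGamma (hubbardOneBody (fermionTorusGraph 2 L) 1 μ)) ≠ 0 :=
    (Matrix.partitionFn_pos β (isHermitian_dGamma (isHermitian_hubbardOneBody (fermionTorusGraph 2 L) 1 μ))).ne'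
  -- (1): two-time shifted Wick theorem of k3c5-p1, `ν ≡ ½`
  have h77 := gibbsState_dGamma_twoTime_shiftedHubbardWord_eq_neg_det (isHermitian_hubbardOneBody (fermionTorusGraph 2 L) 1 μ) β
    f (fun i => ((u i : ℝ) : ℂ) * -(β : ℂ)) f' (fun l => ((((β - s) / β + u' l : ℝ) : ℂ)) * -(β : ℂ))
    (FermionTorus.ofTorusSite xe) (FermionTorus.ofTorusSite ye) σ σ' ((((β - s) / β : ℝ) : ℂ) * -(β : ℂ)) (fun _ => ((1 / 2 : ℝ) : ℂ))
  rw [hinst] at h77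
  rw [Matrix.gibbsState_apply] at h77
  exact ((inv_mul_eq_iff_eq_mul₀ hZ₀).1 h77).trans (congrArg (fun z : ℂ => Matrix.partitionFn β (dGamma (hubbardOneBody (fermionTorusGraph 2 L) 1 μ)) * -z)
    (det_splitPairMatrix_sub_diagonal_eq_det_beforeRule hL hβ μ σ σ' xe ye hs0 hsβ f f' hu hu' huI hu'I))

end DetChain

end Summit.HubbardSuperconductivity.HubbardSuperconductivity.Theorems.TwoPointAssembly

end
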